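import Summits.QuantumFields.YangMills.Theorems.BalabanUVNodesN21HistoriesAbsorbingDefs

/-!
# YM-DAG node N21 (= NE7c) — ROW A⁶ «ABSORBING JUNCTION»: modules 20e ∕ 23c VERBATIM at ABSORBING term laws — their two last non-print binders `hcloseX` (ν_τ-a.e. two-run
# closeness, unconditional) and `hresX` (resummation of the `histLaw` letters) become PRINT-SHAPED: N16's DETERMINISTIC closeness `hdet` + the GEOMETRY `hgeom` of enlarged
# large-field regions + absorption `habs`, and the plain partition `Σ_τ ν_τ = γ_t` of the tilted law into term laws; the letters ARE print's term masses and E1 reads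
# `schemeZ = Σ_τ ν^A_τ(univ)` — the lens's `Sketch-nearmiss-g8.lean` §A3 ∕ §A4 VERBATIM

Track A of `YM-PLAN.md` (cell `pub-ymgap`, HUMAN RULING D-0062), node **N21**; R134 fan-out seat `pub-ymgap-dag-n21-d` (s2), generation 6, module 20l.  THEOREMS ONLY: 0 `def`,
0 `sorry`, standard axioms; COUNT-NEUTRAL; KEY-FREE (generic `D : FiniteEpsData F G`); `--supports` the K3⁗ item `SpineGivenEndpointR13Sep` (stmt-QuantumFields-20292) as a helper.
NO Theses import, NO `Node00.Record13` import.  THIS FILE IS the planner seat `ym-lens-BalabanUVNodes-nearmiss` g8's farm-checked sketch `Sketch-nearmiss-g8.lean` (sha16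
3aad32c4939bea33) §A3 ∕ §A4 ∕ §C VERBATIM (namespace renamed; CREDIT: ym-lens-BalabanUVNodes-nearmiss g8, memo `LENS-nearmiss.md` v8.0 850d044907e0bb17, Card 22, FAN-OUT ROW A⁶).  Imports
module 20k `BalabanUVNodesN21HistoriesAbsorbingDefs` (`Absorbing`, `ae_close_of_absorbing`, `sum_histLaw_eq_of_absorbing`, `histWeight_of_absorbing`, `histShell_of_absorbing`,
`histPiece_of_absorbing`; brings 20e `levelLedgers_∕shellWeightBound_histories_of_resummation`, 23c `schemeZ_eq_sum_histWeight_of_resummation_through` ∕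
`shellWeightBound_histories_of_resummation_through`).

WHAT IS PROVED ([folklore]; each junction ONE application of 20e ∕ 23c).
* §1 `levelLedgers_histories_of_absorbing` ∕ `shellWeightBound_histories_of_absorbing` — 20e with (`hcloseX`, `hresX`) ↦ (`hdetX` N16-det pointwise at nominal θ, law-free ∕ t-free ∕
  a-free; `hgeom : nbhd ⊆ smAll`; `hsub : small ⊆ smAll`; `habsX` absorbing on `smAll` at the selected `a`; `hsumX : Σ_{τ∈T K} ν^X_τ = γ^X_t`), SAME constants; `letters_of_absorbing`
  (`A = ν_τ(univ)`, `sh^A = ∫(1 − ∏χ_a(u^B)) dν^A_τ`, the pieces likewise — the letters ARE print's term masses).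
* §2 `shellWeightBound_histories_of_absorbing_through` — 23c's junction with the same replacement (`hsumX : Σ_τ ν^X_τ = Γ0^X K·e^{t·F∘π^X K}`); `schemeZ_eq_sum_mass_of_absorbing_through`
  — E1 IN PRINT's WORDS: `schemeZ (D.scheme g₀) os (K₀ + K) t = Σ_τ (ν^A_τ univ).toReal` (needs the marginal identity `hmargA` + `hsumA`).
* §3 (lens Card 24) SUB-RESUMMATION + TOTAL MASS = RESUMMATION: `measure_eq_of_le_of_univ_le` (μ ≤ ν finite, ν univ ≤ μ univ ⇒ μ = ν), `isFiniteMeasure_of_le_smul`,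
  `resummation_of_sub_of_univ_le` — 20e's `hresX` ⇐ (U) `Σ_τ histLaw_τ ≤ γ_t` (what a SUB-Markov identity-selector tower gives) + (L) ONE total-mass identity per (K, t).

HONEST FRAMING (binding).  DISPLAYED after this file on the histories road: NODE O's common spaces `Ω K`, t-free finite laws `Γ0^X K`, measurable projections `π^X K`, TERM LAWS
`ν^X K a t τ` ABSORBING on their live-small regions `smAll K τ` and SUMMING to the tilted law (for def-T's tower shape: 20k `absorbing_towerLaw` + `sum_withDensity_towerWeight` from
`isStepUnity_wOfRecordAt` ∕ `front_absorb_at` + Markov kernels — NODE O's (t-n⁵)), statistics `u^X K`, index data (`T`, `small ⊆ smAll`, `C`, `lvl`, `nbhd ⊆ smAll`); N16-det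
`hdet`; N20's window; `hΔ`; box; rate; `AvgMeasurable`; the marginal identity (E1 only).  [folklore] measure theory; nothing of Bałaban's asserted; (M1) at FIXED thresholds
untouched; NE7c is NOT PRINTED and NOT PROVED; **N21 is NOT discharged**; K3⁗ NOT claimed; typed 28∕28, discharged count untouched; one finite four-torus programme at fixed `ε` —
NOT ℝ⁴, NOT infinite volume, NOT OS, NOT a mass gap, NOT Clay.  No decl below carries a cite tag.
-/

set_option autoImplicit false

noncomputable section

open scoped BigOperators ENNReal
open MeasureTheory Set

namespace Summit.QuantumFields.YangMills.Theorems.N21HistoriesAbsorbingJunction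

open Literature.MathematicalPhysics.QuantumFieldTheory.Balaban1983to89
open Literature.MathematicalPhysics.QuantumFieldTheory.Balaban1983to89.T4IndicatorShell (smallInd smallInd_nonneg smallInd_le_one ShellWeightBound)
open T4ShellMeasureLevels (LevelLedger LiveWindow)
open Summit.QuantumFields.BalabanUV.T4Continuum.ShellMeasureRootCompositionPush (measurable_smallInd)
open Summit.QuantumFields.BalabanUV.T4Continuum.ShellMeasureRootCompositionHistories
  (smallProd smallProd_nonneg smallProd_le_one measurable_smallProd histWeight histShell histPiece histLaw)
open Summit.QuantumFields.YangMills.Theorems.N21SelectedThresholdsHistoriesResummation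
  (levelLedgers_histories_of_resummation shellWeightBound_histories_of_resummation)
open Summit.QuantumFields.YangMills.Theorems.N21HistoriesModelADefs
  (causalFactor causalFactor_nonneg measurable_causalFactor liveSmall restFactor restFactor_nonneg measurable_restFactor
    restFactor_mul_smallProd modelAWeight sum_histLaw_modelA withDensity_finsetSum')
open Summit.QuantumFields.YangMills.Theorems.N21HistoriesWindowedModelADefs
  (smallEvent smallProd_eq_one_of_mem smallProd_eq_zero_of_not_mem measurableSet_smallEvent causalFactor_le_one
    liveSmallW restFactorW modelAWeightW liveSmallW_subset restFactorW_nonneg measurable_restFactorW restFactorW_mul_smallProd)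
open Summit.QuantumFields.YangMills.Theorems.N21HistoriesConditionalCloseness (histLaw_restrict ae_restrict_smallEvent_iff)
open Summit.QuantumFields.YangMills.Theorems.N21HistoriesAbsorbingDefs

/-! ## §A3 the junction: module 20e VERBATIM at absorbing term laws -/

section Junction

variable {Ω : ℕ → Type*} [∀ K, MeasurableSpace (Ω K)] {σ ι : Type*} [DecidableEq σ]
  {T : ℕ → Finset ι} {C : ℕ → Finset σ} {small smAll : ℕ → ι → Finset σ} {nbhd : ℕ → ι → σ → Finset σ} {lvl : ℕ → σ → ℕ}
  {νA νB : ∀ K : ℕ, (ℕ → ℝ) → ℝ → ι → Measure (Ω K)} [∀ K a t τ, IsFiniteMeasure (νA K a t τ)] [∀ K a t τ, IsFiniteMeasure (νB K a t τ)]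
  {γ0A γ0B : ∀ K : ℕ, Measure (Ω K)} [∀ K, IsFiniteMeasure (γ0A K)] [∀ K, IsFiniteMeasure (γ0B K)]
  {γtA γtB : ∀ K : ℕ, ℝ → Measure (Ω K)}
  {uA uB : ∀ K : ℕ, σ → Ω K → ℝ} {θ κ ρ Δ : ℕ → ℝ} {l₀ M νbar : ℝ}

/-- **BOTH RUNS' HISTORY LEDGERS AT ABSORBING TERM LAWS.**  Module 20e's `levelLedgers_histories_of_resummation` with its two last non-print
binders REPLACED: `hcloseX` (ν^X_τ-a.e. closeness, unconditional) ⇐ `hdetX` (N16-det: DETERMINISTIC closeness at a window slot whenever run X's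
fields pass their tests on `nbhd K τ s` at the NOMINAL `θ` — law-free, t-free, a-free) + `hgeom` (`nbhd ⊆ smAll`, enlarged regions) + `habsX` (the term
law is absorbing on its whole live-small region `smAll K τ ⊇ small K τ` at the selected `a`); `hresX` ⇐ `hsumX` (the plain partition
`Σ_{τ ∈ T K} ν^X_τ = γ^X_t` of the tilted law into term laws).  Same selected thresholds, same constants. [folklore] -/
theorem levelLedgers_histories_of_absorbing
    (huA : ∀ K s, Measurable (uA K s)) (huB : ∀ K s, Measurable (uB K s))
    (hsmall : ∀ K, ∀ τ ∈ T K, small K τ ⊆ C K)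
    (hθ : ∀ j, 0 < θ j) (hκ : ∀ j, 0 < κ j ∧ κ j ≤ 1) (hρ : ∀ j, 0 ≤ ρ j ∧ ρ j < 1)
    (hcount : ∀ K m, ((((C K).filter fun s => lvl K s = m).card : ℕ) : ℝ) ≤ νbar)
    (hle : ∀ K, ∀ s ∈ C K, lvl K s ≤ K) (hM : 0 < M)
    (hΔ : ∀ j, Δ j ≤ ρ j * ((1 - κ j) * θ j))
    (hsub : ∀ K, ∀ τ ∈ T K, small K τ ⊆ smAll K τ)
    (hgeom : ∀ K, ∀ τ ∈ T K, ∀ s ∈ small K τ, nbhd K τ s ⊆ smAll K τ)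
    (hdetA : ∀ K, ∀ τ ∈ T K, ∀ s ∈ small K τ, ∀ ω, (∀ c ∈ nbhd K τ s, uA K c ω < θ (lvl K c)) → |uA K s ω - uB K s ω| ≤ Δ (lvl K s))
    (hdetB : ∀ K, ∀ τ ∈ T K, ∀ s ∈ small K τ, ∀ ω, (∀ c ∈ nbhd K τ s, uB K c ω < θ (lvl K c)) → |uB K s ω - uA K s ω| ≤ Δ (lvl K s))
    (habsA : ∀ (K : ℕ) (a : ℕ → ℝ), (∀ j, a j ∈ Icc ((1 - κ j) * θ j) (θ j)) → ∀ t, |t| ≤ l₀ → ∀ τ ∈ T K,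
      Absorbing (νA K a t τ) (smAll K τ) (uA K) (fun c => a (lvl K c)))
    (habsB : ∀ (K : ℕ) (a : ℕ → ℝ), (∀ j, a j ∈ Icc ((1 - κ j) * θ j) (θ j)) → ∀ t, |t| ≤ l₀ → ∀ τ ∈ T K,
      Absorbing (νB K a t τ) (smAll K τ) (uB K) (fun c => a (lvl K c)))
    (htiltA : ∀ K t, |t| ≤ l₀ → γtA K t ≤ ENNReal.ofReal M • γ0A K ∧ γ0A K ≤ ENNReal.ofReal M • γtA K t)
    (htiltB : ∀ K t, |t| ≤ l₀ → γtB K t ≤ ENNReal.ofReal M • γ0B K ∧ γ0B K ≤ ENNReal.ofReal M • γtB K t)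
    (hsumA : ∀ (K : ℕ) (a : ℕ → ℝ), (∀ j, a j ∈ Icc ((1 - κ j) * θ j) (θ j)) → ∀ t, |t| ≤ l₀ → ∑ τ ∈ T K, νA K a t τ = γtA K t)
    (hsumB : ∀ (K : ℕ) (a : ℕ → ℝ), (∀ j, a j ∈ Icc ((1 - κ j) * θ j) (θ j)) → ∀ t, |t| ≤ l₀ → ∑ τ ∈ T K, νB K a t τ = γtB K t) :
    ∃ a : ℕ → ℕ → ℝ, (∀ K j, a K j ∈ Icc ((1 - κ j) * θ j) (θ j)) ∧
      LevelLedger l₀ T (fun K t τ => histWeight (νA K (a K) t τ) (small K τ) (uA K) (fun s => a K (lvl K s)))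
        (fun K t τ => histShell (νA K (a K) t τ) (small K τ) (uA K) (uB K) (fun s => a K (lvl K s))) C
        (fun K t s τ => histPiece (νA K (a K) t τ) (small K τ) (uA K) (uB K) (fun s => a K (lvl K s)) s) lvl
        (fun j => M / M⁻¹ * (2 * νbar / ((1 - ρ j) * κ j))) ρ ∧
      LevelLedger l₀ T (fun K t τ => histWeight (νB K (a K) t τ) (small K τ) (uB K) (fun s => a K (lvl K s)))
        (fun K t τ => histShell (νB K (a K) t τ) (small K τ) (uB K) (uA K) (fun s => a K (lvl K s))) C
        (fun K t s τ => histPiece (νB K (a K) t τ) (small K τ) (uB K) (uA K) (fun s => a K (lvl K s)) s) lvl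
        (fun j => M / M⁻¹ * (2 * νbar / ((1 - ρ j) * κ j))) ρ :=
  levelLedgers_histories_of_resummation huA huB hsmall hθ hκ hρ hcount hle hM hΔ
    (fun K a ha t ht τ hτ => ae_close_of_absorbing (νA K a t τ) (nbhd K τ) (θ := fun c => θ (lvl K c)) (a := fun c => a (lvl K c))
      (Δ := fun s => Δ (lvl K s)) (hdetA K τ hτ) (hgeom K τ hτ) (fun c _ => (ha (lvl K c)).2) (habsA K a ha t ht τ hτ))
    (fun K a ha t ht τ hτ => ae_close_of_absorbing (νB K a t τ) (nbhd K τ) (θ := fun c => θ (lvl K c)) (a := fun c => a (lvl K c))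
      (Δ := fun s => Δ (lvl K s)) (hdetB K τ hτ) (hgeom K τ hτ) (fun c _ => (ha (lvl K c)).2) (habsB K a ha t ht τ hτ))
    htiltA htiltB
    (fun K a ha t ht => (sum_histLaw_eq_of_absorbing (T K) (νA K a t) (small K) (huA K) _
      fun τ hτ => (habsA K a ha t ht τ hτ).mono (hsub K τ hτ)).trans (hsumA K a ha t ht))
    (fun K a ha t ht => (sum_histLaw_eq_of_absorbing (T K) (νB K a t) (small K) (huB K) _
      fun τ hτ => (habsB K a ha t ht τ hτ).mono (hsub K τ hτ)).trans (hsumB K a ha t ht))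

/-- **N21's ROAD I ON HISTORY FAMILIES AT ABSORBING TERM LAWS** — module 20e's `shellWeightBound_histories_of_resummation` with (`hcloseX`, `hresX`)
replaced as in `levelLedgers_histories_of_absorbing`; same constant `C′·ϑ^K`. [folklore] -/
theorem shellWeightBound_histories_of_absorbing {N₁ : ℕ} {κmin c₁ ϑ : ℝ}
    (huA : ∀ K s, Measurable (uA K s)) (huB : ∀ K s, Measurable (uB K s))
    (hsmall : ∀ K, ∀ τ ∈ T K, small K τ ⊆ C K)
    (hθ : ∀ j, 0 < θ j) (hκ : ∀ j, 0 < κ j ∧ κ j ≤ 1) (hρ : ∀ j, 0 ≤ ρ j ∧ ρ j < 1)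
    (hwin : LiveWindow C lvl N₁ νbar) (hM : 0 < M)
    (hΔ : ∀ j, Δ j ≤ ρ j * ((1 - κ j) * θ j))
    (hsub : ∀ K, ∀ τ ∈ T K, small K τ ⊆ smAll K τ)
    (hgeom : ∀ K, ∀ τ ∈ T K, ∀ s ∈ small K τ, nbhd K τ s ⊆ smAll K τ)
    (hdetA : ∀ K, ∀ τ ∈ T K, ∀ s ∈ small K τ, ∀ ω, (∀ c ∈ nbhd K τ s, uA K c ω < θ (lvl K c)) → |uA K s ω - uB K s ω| ≤ Δ (lvl K s))
    (hdetB : ∀ K, ∀ τ ∈ T K, ∀ s ∈ small K τ, ∀ ω, (∀ c ∈ nbhd K τ s, uB K c ω < θ (lvl K c)) → |uB K s ω - uA K s ω| ≤ Δ (lvl K s))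
    (habsA : ∀ (K : ℕ) (a : ℕ → ℝ), (∀ j, a j ∈ Icc ((1 - κ j) * θ j) (θ j)) → ∀ t, |t| ≤ l₀ → ∀ τ ∈ T K,
      Absorbing (νA K a t τ) (smAll K τ) (uA K) (fun c => a (lvl K c)))
    (habsB : ∀ (K : ℕ) (a : ℕ → ℝ), (∀ j, a j ∈ Icc ((1 - κ j) * θ j) (θ j)) → ∀ t, |t| ≤ l₀ → ∀ τ ∈ T K,
      Absorbing (νB K a t τ) (smAll K τ) (uB K) (fun c => a (lvl K c)))
    (htiltA : ∀ K t, |t| ≤ l₀ → γtA K t ≤ ENNReal.ofReal M • γ0A K ∧ γ0A K ≤ ENNReal.ofReal M • γtA K t)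
    (htiltB : ∀ K t, |t| ≤ l₀ → γtB K t ≤ ENNReal.ofReal M • γ0B K ∧ γ0B K ≤ ENNReal.ofReal M • γtB K t)
    (hsumA : ∀ (K : ℕ) (a : ℕ → ℝ), (∀ j, a j ∈ Icc ((1 - κ j) * θ j) (θ j)) → ∀ t, |t| ≤ l₀ → ∑ τ ∈ T K, νA K a t τ = γtA K t)
    (hsumB : ∀ (K : ℕ) (a : ℕ → ℝ), (∀ j, a j ∈ Icc ((1 - κ j) * θ j) (θ j)) → ∀ t, |t| ≤ l₀ → ∑ τ ∈ T K, νB K a t τ = γtB K t)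
    (hκmin : 0 < κmin) (hκminle : ∀ j, κmin ≤ κ j) (hρhalf : ∀ j, ρ j ≤ 1 / 2)
    (hϑ0 : 0 < ϑ) (hϑ1 : ϑ < 1) (hrate : ∀ j, ρ j ≤ c₁ * ϑ ^ j) :
    ∃ a : ℕ → ℕ → ℝ, (∀ K j, a K j ∈ Icc ((1 - κ j) * θ j) (θ j)) ∧
      ShellWeightBound l₀ T (fun K t τ => histWeight (νA K (a K) t τ) (small K τ) (uA K) (fun s => a K (lvl K s)))
        (fun K t τ => histWeight (νB K (a K) t τ) (small K τ) (uB K) (fun s => a K (lvl K s)))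
        (fun K t τ => histShell (νA K (a K) t τ) (small K τ) (uA K) (uB K) (fun s => a K (lvl K s)))
        (fun K t τ => histShell (νB K (a K) t τ) (small K τ) (uB K) (uA K) (fun s => a K (lvl K s)))
        fun K => (2 * ((N₁ + 1) * νbar * (M / M⁻¹ * (2 * (2 * νbar) / κmin)) * c₁ * ϑ⁻¹ ^ N₁)) * ϑ ^ K :=
  shellWeightBound_histories_of_resummation huA huB hsmall hθ hκ hρ hwin hM hΔ
    (fun K a ha t ht τ hτ => ae_close_of_absorbing (νA K a t τ) (nbhd K τ) (θ := fun c => θ (lvl K c)) (a := fun c => a (lvl K c))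
      (Δ := fun s => Δ (lvl K s)) (hdetA K τ hτ) (hgeom K τ hτ) (fun c _ => (ha (lvl K c)).2) (habsA K a ha t ht τ hτ))
    (fun K a ha t ht τ hτ => ae_close_of_absorbing (νB K a t τ) (nbhd K τ) (θ := fun c => θ (lvl K c)) (a := fun c => a (lvl K c))
      (Δ := fun s => Δ (lvl K s)) (hdetB K τ hτ) (hgeom K τ hτ) (fun c _ => (ha (lvl K c)).2) (habsB K a ha t ht τ hτ))
    htiltA htiltB
    (fun K a ha t ht => (sum_histLaw_eq_of_absorbing (T K) (νA K a t) (small K) (huA K) _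
      fun τ hτ => (habsA K a ha t ht τ hτ).mono (hsub K τ hτ)).trans (hsumA K a ha t ht))
    (fun K a ha t ht => (sum_histLaw_eq_of_absorbing (T K) (νB K a t) (small K) (huB K) _
      fun τ hτ => (habsB K a ha t ht τ hτ).mono (hsub K τ hτ)).trans (hsumB K a ha t ht))
    hκmin hκminle hρhalf hϑ0 hϑ1 hrate

omit [DecidableEq σ] [∀ K a t τ, IsFiniteMeasure (νA K a t τ)] in
/-- **… AND THE LETTERS IT BOUNDS ARE PRINT's**: at the absorbing term laws the two history families' letters are term masses and the other run's
large-field masses — `A_K(t,τ) = ν^A_τ(univ)`, `sh^A_K(t,τ) = ∫ (1 − ∏_{s ∈ small τ} χ_{a}(u^B_s)) dν^A_τ`. [folklore] -/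
theorem letters_of_absorbing (K : ℕ) (a : ℕ → ℝ) (t : ℝ) (τ : ι) (hsub : small K τ ⊆ smAll K τ)
    (habsA : Absorbing (νA K a t τ) (smAll K τ) (uA K) (fun c => a (lvl K c))) :
    histWeight (νA K a t τ) (small K τ) (uA K) (fun s => a (lvl K s)) = ((νA K a t τ) univ).toReal ∧
      histShell (νA K a t τ) (small K τ) (uA K) (uB K) (fun s => a (lvl K s)) =
        ∫ ω, (1 - smallProd (small K τ) (uB K) (fun s => a (lvl K s)) ω) ∂(νA K a t τ) :=
  ⟨histWeight_of_absorbing _ _ _ (habsA.mono hsub), histShell_of_absorbing _ _ _ _ (habsA.mono hsub)⟩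

end Junction

/-! ## §A4 the same at the record's carrier: module 23c VERBATIM at absorbing term laws, and E1 in print's words -/

section Through

open Literature.MathematicalPhysics.QuantumFieldTheory.Balaban1983to89.T4Continuum (T4Family ULoop FiniteEpsData)
open T4GenFunBounds (prodObs schemeZ)
open Missing (boltzmann)
open Summit.QuantumFields.YangMills.Theorems.N21SourceTiltJointSpace
  (schemeZ_eq_sum_histWeight_of_resummation_through shellWeightBound_histories_of_resummation_through)

variable {F : T4Family} {G : Type*} [GaugeGroup G] [MeasurableSpace G] [HaarData G] [RegularGaugeGroup G]
  (D : FiniteEpsData F G) (g₀ : ℕ → ℝ) (os : List (ULoop F)) (K₀ : ℕ)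
  {Ω : ℕ → Type*} [∀ K, MeasurableSpace (Ω K)] {σ ι : Type*} [DecidableEq σ]
  {T : ℕ → Finset ι} {C : ℕ → Finset σ} {small smAll : ℕ → ι → Finset σ} {nbhd : ℕ → ι → σ → Finset σ} {lvl : ℕ → σ → ℕ}
  {νA νB : ∀ K : ℕ, (ℕ → ℝ) → ℝ → ι → Measure (Ω K)} [∀ K a t τ, IsFiniteMeasure (νA K a t τ)] [∀ K a t τ, IsFiniteMeasure (νB K a t τ)]
  {Γ0A Γ0B : ∀ K : ℕ, Measure (Ω K)} [∀ K, IsFiniteMeasure (Γ0A K)] [∀ K, IsFiniteMeasure (Γ0B K)]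
  {πA : ∀ K : ℕ, Ω K → GaugeField ((D.scheme g₀).P (K₀ + K)) 0 G} {πB : ∀ K : ℕ, Ω K → GaugeField ((D.scheme g₀).P (K₀ + K + 1)) 0 G}
  {uA uB : ∀ K : ℕ, σ → Ω K → ℝ} {θ κ ρ Δ : ℕ → ℝ} {l₀ νbar : ℝ}

/-- **N21's ROAD I AT ABSORBING TERM LAWS, TILT THROUGH THE LEVEL-0 PROJECTIONS** — module 23c's `shellWeightBound_histories_of_resummation_through` with
(`hcloseX`, `hresX`) REPLACED by (`hdetX`, `hgeom`, `hsub`, `habsX`, `hsumX : Σ_{τ ∈ T K} ν^X_τ = Γ0^X K·e^{t·F∘π^X K}`).  DISPLAYED after this: NODE O's common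
spaces `Ω K`, t-free finite laws `Γ0^X K`, measurable projections `π^X K`, TERM LAWS `ν^X K a t τ` (absorbing on their live-small regions `smAll K τ`, summing
to the tilted law), statistics `u^X K`, index data (`T`, `small ⊆ smAll`, `C`, `lvl`, `nbhd ⊆ smAll`); N16-det; N20's window; box ∕ rate; `AvgMeasurable`. [folklore] -/
theorem shellWeightBound_histories_of_absorbing_through {N₁ : ℕ} {κmin c₁ ϑ : ℝ} (hM : D.AvgMeasurable)
    (hπA : ∀ K, Measurable (πA K)) (hπB : ∀ K, Measurable (πB K))
    (huA : ∀ K s, Measurable (uA K s)) (huB : ∀ K s, Measurable (uB K s))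
    (hsmall : ∀ K, ∀ τ ∈ T K, small K τ ⊆ C K)
    (hθ : ∀ j, 0 < θ j) (hκ : ∀ j, 0 < κ j ∧ κ j ≤ 1) (hρ : ∀ j, 0 ≤ ρ j ∧ ρ j < 1)
    (hwin : LiveWindow C lvl N₁ νbar)
    (hΔ : ∀ j, Δ j ≤ ρ j * ((1 - κ j) * θ j))
    (hsub : ∀ K, ∀ τ ∈ T K, small K τ ⊆ smAll K τ)
    (hgeom : ∀ K, ∀ τ ∈ T K, ∀ s ∈ small K τ, nbhd K τ s ⊆ smAll K τ)
    (hdetA : ∀ K, ∀ τ ∈ T K, ∀ s ∈ small K τ, ∀ ω, (∀ c ∈ nbhd K τ s, uA K c ω < θ (lvl K c)) → |uA K s ω - uB K s ω| ≤ Δ (lvl K s))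
    (hdetB : ∀ K, ∀ τ ∈ T K, ∀ s ∈ small K τ, ∀ ω, (∀ c ∈ nbhd K τ s, uB K c ω < θ (lvl K c)) → |uB K s ω - uA K s ω| ≤ Δ (lvl K s))
    (habsA : ∀ (K : ℕ) (a : ℕ → ℝ), (∀ j, a j ∈ Icc ((1 - κ j) * θ j) (θ j)) → ∀ t, |t| ≤ l₀ → ∀ τ ∈ T K,
      Absorbing (νA K a t τ) (smAll K τ) (uA K) (fun c => a (lvl K c)))
    (habsB : ∀ (K : ℕ) (a : ℕ → ℝ), (∀ j, a j ∈ Icc ((1 - κ j) * θ j) (θ j)) → ∀ t, |t| ≤ l₀ → ∀ τ ∈ T K,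
      Absorbing (νB K a t τ) (smAll K τ) (uB K) (fun c => a (lvl K c)))
    (hsumA : ∀ (K : ℕ) (a : ℕ → ℝ), (∀ j, a j ∈ Icc ((1 - κ j) * θ j) (θ j)) → ∀ t, |t| ≤ l₀ →
      ∑ τ ∈ T K, νA K a t τ = (Γ0A K).withDensity (fun ω => ENNReal.ofReal (Real.exp (t * prodObs (D.scheme g₀) (K₀ + K) os (πA K ω)))))
    (hsumB : ∀ (K : ℕ) (a : ℕ → ℝ), (∀ j, a j ∈ Icc ((1 - κ j) * θ j) (θ j)) → ∀ t, |t| ≤ l₀ →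
      ∑ τ ∈ T K, νB K a t τ = (Γ0B K).withDensity (fun ω => ENNReal.ofReal (Real.exp (t * prodObs (D.scheme g₀) (K₀ + K + 1) os (πB K ω)))))
    (hκmin : 0 < κmin) (hκminle : ∀ j, κmin ≤ κ j) (hρhalf : ∀ j, ρ j ≤ 1 / 2)
    (hϑ0 : 0 < ϑ) (hϑ1 : ϑ < 1) (hrate : ∀ j, ρ j ≤ c₁ * ϑ ^ j) :
    ∃ a : ℕ → ℕ → ℝ, (∀ K j, a K j ∈ Icc ((1 - κ j) * θ j) (θ j)) ∧
      ShellWeightBound l₀ T (fun K t τ => histWeight (νA K (a K) t τ) (small K τ) (uA K) (fun s => a K (lvl K s)))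
        (fun K t τ => histWeight (νB K (a K) t τ) (small K τ) (uB K) (fun s => a K (lvl K s)))
        (fun K t τ => histShell (νA K (a K) t τ) (small K τ) (uA K) (uB K) (fun s => a K (lvl K s)))
        (fun K t τ => histShell (νB K (a K) t τ) (small K τ) (uB K) (uA K) (fun s => a K (lvl K s)))
        fun K => (2 * ((N₁ + 1) * νbar * (Real.exp l₀ / (Real.exp l₀)⁻¹ * (2 * (2 * νbar) / κmin)) * c₁ * ϑ⁻¹ ^ N₁)) * ϑ ^ K :=
  shellWeightBound_histories_of_resummation_through D g₀ os K₀ hM hπA hπB huA huB hsmall hθ hκ hρ hwin hΔ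
    (fun K a ha t ht τ hτ => ae_close_of_absorbing (νA K a t τ) (nbhd K τ) (θ := fun c => θ (lvl K c)) (a := fun c => a (lvl K c))
      (Δ := fun s => Δ (lvl K s)) (hdetA K τ hτ) (hgeom K τ hτ) (fun c _ => (ha (lvl K c)).2) (habsA K a ha t ht τ hτ))
    (fun K a ha t ht τ hτ => ae_close_of_absorbing (νB K a t τ) (nbhd K τ) (θ := fun c => θ (lvl K c)) (a := fun c => a (lvl K c))
      (Δ := fun s => Δ (lvl K s)) (hdetB K τ hτ) (hgeom K τ hτ) (fun c _ => (ha (lvl K c)).2) (habsB K a ha t ht τ hτ))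
    (fun K a ha t ht => (sum_histLaw_eq_of_absorbing (T K) (νA K a t) (small K) (huA K) _
      fun τ hτ => (habsA K a ha t ht τ hτ).mono (hsub K τ hτ)).trans (hsumA K a ha t ht))
    (fun K a ha t ht => (sum_histLaw_eq_of_absorbing (T K) (νB K a t) (small K) (huB K) _
      fun τ hτ => (habsB K a ha t ht τ hτ).mono (hsub K τ hτ)).trans (hsumB K a ha t ht))
    hκmin hκminle hρhalf hϑ0 hϑ1 hrate

omit [DecidableEq σ] [∀ K a t τ, IsFiniteMeasure (νB K a t τ)] [∀ K, IsFiniteMeasure (Γ0A K)] [∀ K, IsFiniteMeasure (Γ0B K)] in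
/-- **E1 IN PRINT's WORDS**: at absorbing term laws summing to the t-free law tilted through the level-0 projection, with the level-0 marginal the Boltzmann law
of record, THE TERM MASSES SUM TO `Z`: `schemeZ (D.scheme g₀) os (K₀ + K) t = Σ_{τ ∈ T K} ν^A_τ(univ)` (23c `schemeZ_eq_sum_histWeight_of_resummation_through`
+ §A2). [folklore] -/
theorem schemeZ_eq_sum_mass_of_absorbing_through (hM : D.AvgMeasurable) (hπA : ∀ K, Measurable (πA K))
    (hmargA : ∀ K, (Γ0A K).map (πA K) = (fieldMeasure ((D.scheme g₀).P (K₀ + K)) 0 G).withDensity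
      (fun U => ENNReal.ofReal (boltzmann ((D.scheme g₀).P (K₀ + K)) ((D.scheme g₀).β (K₀ + K)) U)))
    (huA : ∀ K s, Measurable (uA K s)) (K : ℕ) (a : ℕ → ℝ) (t : ℝ)
    (hsub : ∀ τ ∈ T K, small K τ ⊆ smAll K τ)
    (habsA : ∀ τ ∈ T K, Absorbing (νA K a t τ) (smAll K τ) (uA K) (fun c => a (lvl K c)))
    (hsumA : ∑ τ ∈ T K, νA K a t τ =
      (Γ0A K).withDensity (fun ω => ENNReal.ofReal (Real.exp (t * prodObs (D.scheme g₀) (K₀ + K) os (πA K ω))))) :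
    schemeZ (D.scheme g₀) os (K₀ + K) t = ∑ τ ∈ T K, ((νA K a t τ) univ).toReal := by
  rw [schemeZ_eq_sum_histWeight_of_resummation_through D g₀ os K₀ hM hπA hmargA huA K a t
    ((sum_histLaw_eq_of_absorbing (T K) (νA K a t) (small K) (huA K) _ fun τ hτ => (habsA τ hτ).mono (hsub τ hτ)).trans hsumA)]
  exact Finset.sum_congr rfl fun τ hτ => histWeight_of_absorbing _ _ _ ((habsA τ hτ).mono (hsub τ hτ))

end Through

/-! ## §C Card 24: sub-resummation + total mass = resummation -/

section SubResum

variable {Ω : Type*} [MeasurableSpace Ω]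

/-- **RECONCILIATION**: a measure below a finite measure with at least its total mass IS it. [folklore] -/
theorem measure_eq_of_le_of_univ_le {μ ν : Measure Ω} [IsFiniteMeasure ν] (hle : μ ≤ ν) (huniv : ν univ ≤ μ univ) : μ = ν := by
  ext s hs
  refine le_antisymm (Measure.le_iff'.1 hle s) ((ENNReal.add_le_add_iff_right (measure_ne_top ν sᶜ)).1 ?_)
  calc ν s + ν sᶜ = ν univ := measure_add_measure_compl hs
    _ ≤ μ univ := huniv
    _ = μ s + μ sᶜ := (measure_add_measure_compl hs).symm
    _ ≤ μ s + ν sᶜ := add_le_add le_rfl (Measure.le_iff'.1 hle sᶜ)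

/-- a measure below a finite multiple of a finite measure is finite (20e's `γ_t ≤ M • γ_0`). [folklore] -/
theorem isFiniteMeasure_of_le_smul {γt γ0 : Measure Ω} [IsFiniteMeasure γ0] {M : ℝ} (h : γt ≤ ENNReal.ofReal M • γ0) :
    IsFiniteMeasure γt :=
  ⟨lt_of_le_of_lt (Measure.le_iff'.1 h univ) (by
    rw [Measure.smul_apply, smul_eq_mul]
    exact ENNReal.mul_lt_top ENNReal.ofReal_lt_top (measure_lt_top _ _))⟩

/-- **20e's `hresX` FROM (U) SUB-RESUMMATION + (L) TOTAL MASS**: `Σ_τ histLaw_τ ≤ γ_t` (sub-Markov kernel algebra — dag-n19-d's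
`withDensity_margDensity_le`, no `HaarAC`) and `γ_t(univ) ≤ (Σ_τ histLaw_τ)(univ)` (the scalar E1 + lower tilt) give the equality. [folklore] -/
theorem resummation_of_sub_of_univ_le {σ ι : Type*} (T : Finset ι) (ν : ι → Measure Ω) (small : ι → Finset σ) (u : σ → Ω → ℝ)
    (ϑ : σ → ℝ) {γt : Measure Ω} [IsFiniteMeasure γt] (hsub : ∑ τ ∈ T, histLaw (ν τ) (small τ) u ϑ ≤ γt)
    (hlow : γt univ ≤ (∑ τ ∈ T, histLaw (ν τ) (small τ) u ϑ) univ) : ∑ τ ∈ T, histLaw (ν τ) (small τ) u ϑ = γt :=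
  measure_eq_of_le_of_univ_le hsub hlow

end SubResum

end Summit.QuantumFields.YangMills.Theorems.N21HistoriesAbsorbingJunction

end
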